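import Summits.BirchSwinnertonDyer.BirchSwinnertonDyer.Theorems.GenusKolyvaginAtTwoPowDvdShaCardAtTwoRTCrossPairShaTorsion
import Summits.BirchSwinnertonDyer.BirchSwinnertonDyer.Theorems.GenusKolyvaginAtTwoCasselsTateTotallyComplex
import Summits.BirchSwinnertonDyer.BirchSwinnertonDyer.Theorems.Rank1ResidualJetWeilDatumConj
import Literature.NumberTheory.GaloisCohomology.LocalInvariantMapConjCompatible
import Summits.BirchSwinnertonDyer.BirchSwinnertonDyer.Theorems.GenusKolyvaginAtTwoVisiblePairAtTwoCasselsTateValue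
import Literature.NumberTheory.EllipticCurves.TwoTorsionOddDegreeBaseChangeProofs
import HarnessLib

/-!
# Route `GenusKolyvaginAtTwo`, crux L_T `PowDvdShaCardAtTwoRT` (stmt-BirchSwinnertonDyer-23299), LINE 18, road (E4) — socket X-ORTH:
# THE LEVEL PAIRING ON `Ш(E/K)[2^k]` over the Heegner field, with X-ORTH for every opposite-sign Kolyvagin pair — all analytic inputs
# (Weil pairing, canonical invariants, reciprocity, `Ш³(K, μ) = 0`, finite support, Cassels' alternation) DISCHARGED by name

Seat `bsd-line-gk2-p4` g20 (WIDTH-5 attach, cell `bsd-f1-sign2`), `--supports` the crux L_T (helper; closes nothing).  THEOREMS ONLY (no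
definition, no named fact, no `sorry`); BSD is not proved by any of this; neither is L_T nor any stub.

WHY (memo `Cruxes/PowDvdShaCardAtTwoRT/Lines/plus-descent-deep-orthogonality-gk2p4.md` §1, §4, §9).  The K-side count
`…RTOrthogonalLadders.pow_two_mul_dvd_natCard_sha_of_orthogonal_ladders(_of_dvd_two)` (p735742) wants ONE level pairing `B` on `Ш(E/K)[2^k]`
with the kernel clause, and `B(U, U′) = 0` for the spans of the two opposite-sign Kolyvagin families.  This file produces that `B` once and for
all, by name, over the Heegner field `K` (imaginary quadratic ⟹ totally complex):
* `B := ctLevelPairing` of the LIFT-EQUIVARIANT Weil pairing `e` on `E[2^{2k}]` (`JET.GlobalDuality.exists_weilPairing_liftEquivariant`) and THE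
  canonical invariant maps (`LocalInvariants.canonical`; reciprocity `sumInvLocalizationEqZero_canonical_of_numberField`; `Ш³(K, μ) = 0`
  `shaThree_mu_eq_zero_of_isTotallyComplex`; finite support `localTerm_finite_support`);
* it IS a level pairing (`GenusExact.CasselsTateTotallyComplex.isLevelPairing_ctLevelPairing_canonical`, Cassels' alternation inside), whence the
  kernel clause `B x = 0 → x ∈ 2^k Ш` in the exact shape of p735742's `hker`;
* and for it X-ORTH FOR ONE PAIR holds with NO pairing-side hypothesis left: `…RTCrossPairShaTorsion.ctLevelPairing_eq_zero_of_opposite_signs`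
  with `hte` := lift-equivariance of `e` at the conjugation-fixed cross places and `hinvc` := `isConjCompatible_canonical`.
Main statement **`exists_isLevelPairing_forall_opposite_signs_eq_zero`**: for `E/ℚ` with `Δ < 0` over the Heegner field `K` (complex conjugation
`τ`), every `k ≥ 1` with `E(K̄)[2^k]` free of non-zero `Γ_K`-fixed points: **∃ B on `Ш(E/K)[2^k]`, a level pairing (+ kernel clause), such
that `B(x, y) = 0` for ALL `x, y ∈ Ш[2^k]` lying over opposite-sign Kolyvagin-type Selmer classes `z = 2^k • k′ • c`, `t` at level `2^{2k}`**
(hypotheses on the classes and their places only: Kummer off `Sn`, `2^k • loc = 0` on `Sn`, `loc t = 0` and `E[2^{2k}] ⊂ E(K_q)` on `Sn′`, deep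
inert Kolyvagin places on `Sn ∖ Sn′` with `2k ≤ M(ℓ)` and `FrobEqFrobInfty W K (2^{2k}) ℓ`).  The fixed-point hypothesis is
DISCHARGED on the LINE's habitat by `geomTorsion_baseChange_fixed_eq_zero_of_hasSurjectiveModNGaloisRep_two` / `…_of_tower` (`ρ̄_{E,2}` onto and
`[K:ℚ] = 2`: Dokchitser–Dokchitser (1) + Silverman Ex. III.3.7(d) + Galois descent) — pass it as the `hnofix` argument.  What then remains for L_T on road (E4) is the K-side capstone proper
(gk2-p2 `…RTOrthogonalCapstone*`, gk2-p5's provenance adapter): feed KS's two families (as elements of `Ш[2^k]`) and this `B` to p735742.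

References: [McCallumLMS1991] §4 Prop. 4.7, §5 Lemma 5.3, Thm. 5.4; [MilneADT2006] I §6 Prop. 6.9, Thm. 6.13 (a); [Cassels1962ArithmeticIV];
[SilvermanAEC2009] III.8.1; [Kolyvagin1991StructureSha].
-/

set_option autoImplicit false

noncomputable section

open scoped Classical
open scoped AddSubgroup
open Function Field NumberField IsDedekindDomain WeierstrassCurve
open Literature.NumberTheory.EllipticCurves Literature.NumberTheory.GaloisRepresentations
open Literature.NumberTheory.GaloisCohomology
open Literature.NumberTheory.GaloisRepresentations.DiscreteGaloisModule (mu)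
open Literature.NumberTheory.Automorphic
open Literature.GroupTheory.FiniteAbelian (IsLevelPairing)
open Summit.BirchSwinnertonDyer.Rank1Residual.X11b.Relaxation
open Summit.BirchSwinnertonDyer.Rank1Residual.JET.GlobalDuality
open Summit.BirchSwinnertonDyer.BirchSwinnertonDyer.Theorems.GenusExact.CasselsTatePTc
open Summit.BirchSwinnertonDyer.BirchSwinnertonDyer.Theorems.GenusExact.CasselsTateTotallyComplex

-- the Theorems namespace of this sub repeats the summit name by design (D-0017 nested layout)
set_option linter.dupNamespace false

namespace Summit.BirchSwinnertonDyer.BirchSwinnertonDyer.Theorems.GenusExact.PlusDescent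

section Kernel

variable {G : Type*} [AddCommGroup G] {T : Type*} [AddCommGroup T] {q : ℕ}

/-- The kernel clause of a level pairing in the shape of `…RTOrthogonalLadders`' `hker`: `B x = 0 ⟹ x ∈ qG`. [folklore]
[cite: MilneADT2006, Ch. I §6, Thm. 6.13 (a)] -/
theorem exists_smul_eq_of_isLevelPairing_of_apply_eq_zero {B : G[q] →+ G[q] →+ T} (hB : IsLevelPairing q B) (x : G[q]) (hx : B x = 0) :
    ∃ z : G, q • z = (x : G) :=
  (hB.2 x).mp fun y => by rw [hx, AddMonoidHom.zero_apply]

end Kernel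

section NoFixed

variable (W : WeierstrassCurve ℚ) (K : Type) [Field K] [NumberField K] [W.IsElliptic]

/-- **`E(K̄)[2^L]` has no non-zero `Γ_K`-fixed point** for `E/ℚ` with `ρ̄_{E,2}` onto and `K` imaginary quadratic: `E(ℚ)[2] = 0`
(Dokchitser–Dokchitser (1)), hence `E(K)[2] = 0` as `3 ∤ [K:ℚ] = 2` (`forall_two_nsmul_baseChange_of_hasSurjectiveModNGaloisRep_two`), hence no
fixed geometric `2`-power torsion (`VisiblePairAtTwo.geomTorsion_fixed_eq_zero_of_forall_two_nsmul`, Galois descent).  This is the hypothesis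
`hnofix` of the one-pair theorems (`…CrossPairTerm`, `…CrossPairShaTorsion`) on the LINE's habitat. [cite: DokchitserDokchitserMathZ2012, Theorem (1)]
[cite: SilvermanAEC2009, Ex. III.3.7 (d), VIII.§1] -/
theorem geomTorsion_baseChange_fixed_eq_zero_of_hasSurjectiveModNGaloisRep_two (hs : W.HasSurjectiveModNGaloisRep 2)
    (hK : IsImaginaryQuadratic K) (L : ℕ) :
    ∀ P : geomTorsion (W.baseChange K) ((2 ^ L : ℕ) : ℤ), (∀ g : absoluteGaloisGroup K, g • P = P) → P = 0 :=
  fun P hP => VisiblePairAtTwo.geomTorsion_fixed_eq_zero_of_forall_two_nsmul (W.baseChange K)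
    (forall_two_nsmul_baseChange_of_hasSurjectiveModNGaloisRep_two W hs K (by rw [hK.1]; decide)) L P hP

/-- The same from the LINE's tower binder `∀ n > 0, ρ̄_{E,2^n} onto` (only `n = 1` is used). [cite: DokchitserDokchitserMathZ2012, Theorem (1)]
[cite: SilvermanAEC2009, Ex. III.3.7 (d)] -/
theorem geomTorsion_baseChange_fixed_eq_zero_of_tower (hsurj : ∀ n : ℕ, 0 < n → W.HasSurjectiveModNGaloisRep ((2 : ℤ) ^ n))
    (hK : IsImaginaryQuadratic K) (L : ℕ) :
    ∀ P : geomTorsion (W.baseChange K) ((2 ^ L : ℕ) : ℤ), (∀ g : absoluteGaloisGroup K, g • P = P) → P = 0 :=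
  geomTorsion_baseChange_fixed_eq_zero_of_hasSurjectiveModNGaloisRep_two W K (by simpa using hsurj 1 one_pos) hK L

end NoFixed

section Main

variable (W : WeierstrassCurve ℚ) (K : Type) [Field K] [NumberField K] [W.IsElliptic] [W.IsGloballyMinimal]

/-- **The level pairing on `Ш(E/K)[2^k]` over the Heegner field, orthogonal on every opposite-sign Kolyvagin pair.**  `E/ℚ` with `Δ < 0`, `K`
imaginary quadratic with complex conjugation `τ` (`τ ≠ 1`, `τ² = 1`), `k ≥ 1`, `E(K̄)[2^k]` without non-zero `Γ_K`-fixed points.  Then there is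
`B : Ш[2^k] × Ш[2^k] → ℚ/ℤ` — the Cassels–Tate pairing of the lift-equivariant Weil pairing on `E[2^{2k}]` and the canonical invariant maps —
which (i) is a LEVEL pairing (`IsLevelPairing (2^k) B`: alternating, kernel `Ш[2^k] ∩ 2^kШ`), (ii) hence satisfies the kernel clause
`B x = 0 → ∃ z ∈ Ш, 2^k • z = x`, and (iii) VANISHES on every pair `x, y ∈ Ш[2^k]` lying over Selmer classes `z = 2^k • k′ • c`, `t`
(`2^k • t = 0`) at level `2^{2k}` of OPPOSITE `τ_*`-signs (`τ_*(k′•c) = s·(k′•c)`, `τ_* t = −(s·t)`), granted the place data of a Kolyvagin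
pair: `c` Selmer off the finite places `Sn` and `2^k • loc_q (k′•c) = 0` on `Sn`; `loc_q t = 0` and `E[2^{2k}] ⊂ E(K_q)` on `Sn′`; every
`q ∈ Sn ∖ Sn′` below a Kolyvagin prime `ℓ ∈ q` with `τ•q = q`, `2k ≤ M(ℓ)` and `FrobEqFrobInfty W K (2^{2k}) ℓ`.  (iii) is McCallum's Prop. 4.7 as
a sum of local terms all of which vanish (`…RTCrossPairShaTorsion`), the cross ones by the regular-module eigen/norm argument of
`…RTCrossSignLocalVanishing`; (i) is Milne I 6.13(a) over a totally complex field with Cassels' alternation (`GenusExact.CasselsTateTotallyComplex`).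
[cite: McCallumLMS1991, §4 Prop. 4.7, §5 Lemma 5.3, Thm. 5.4] [cite: MilneADT2006, Ch. I §6, Prop. 6.9, Thm. 6.13 (a)] [cite: Cassels1962ArithmeticIV]
[cite: SilvermanAEC2009, Prop. III.8.1] [cite: Kolyvagin1991StructureSha] -/
theorem exists_isLevelPairing_forall_opposite_signs_eq_zero (hK : IsImaginaryQuadratic K) (hΔ : W.Δ < 0) (k : ℕ) (hk : 0 < k)
    {τ : K ≃ₐ[ℚ] K} (hτ1 : τ ≠ 1) (hττ : τ * τ = 1)
    (hnofix : ∀ P : geomTorsion (W.baseChange K) ((2 ^ k : ℕ) : ℤ), (∀ g : absoluteGaloisGroup K, g • P = P) → P = 0) :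
    ∃ B : ((W.baseChange K).sha)[((2 ^ k : ℕ) : ℤ)] →+ ((W.baseChange K).sha)[((2 ^ k : ℕ) : ℤ)] →+ AddCircle (1 : ℚ),
      IsLevelPairing (2 ^ k) B ∧
      (∀ x : ((W.baseChange K).sha)[((2 ^ k : ℕ) : ℤ)], B x = 0 → ∃ a : (W.baseChange K).sha, (2 ^ k) • a = (x : (W.baseChange K).sha)) ∧
      ∀ (x y : ((W.baseChange K).sha)[((2 ^ k : ℕ) : ℤ)]) (z t : selmerGroup (W.baseChange K) ((2 ^ k * 2 ^ k : ℕ) : ℤ))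
        (_hx : shaTorsionVal (W.baseChange K) (2 ^ k) x = torsionH1ToH1 (W.baseChange K) ((2 ^ k * 2 ^ k : ℕ) : ℤ) z)
        (_hy : shaTorsionVal (W.baseChange K) (2 ^ k) y = torsionH1ToH1 (W.baseChange K) ((2 ^ k * 2 ^ k : ℕ) : ℤ) t)
        (c : galoisCohomology ((W.baseChange K).torsionGaloisModule ((2 ^ k * 2 ^ k : ℕ) : ℤ)) 1) (k' : ℤ)
        (_hz : (z : galH1Torsion (W.baseChange K) ((2 ^ k * 2 ^ k : ℕ) : ℤ)) = ((2 ^ k : ℕ) : ℤ) • k' • c)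
        (_hmt : ((2 ^ k : ℕ) : ℤ) • (t : galH1Torsion (W.baseChange K) ((2 ^ k * 2 ^ k : ℕ) : ℤ)) = 0)
        (s : ℤ) (_hsc : conjAct W τ ((2 ^ k * 2 ^ k : ℕ) : ℤ) (k' • c) = s • (k' • c))
        (_hst : conjAct W τ ((2 ^ k * 2 ^ k : ℕ) : ℤ) (t : galH1Torsion (W.baseChange K) ((2 ^ k * 2 ^ k : ℕ) : ℤ)) =
          -(s • (t : galH1Torsion (W.baseChange K) ((2 ^ k * 2 ^ k : ℕ) : ℤ))))
        (Sn Sn' : Set (HeightOneSpectrum (𝓞 K)))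
        (_hc : ∀ v : Place K, (∀ q ∈ Sn, v ≠ Sum.inr q) →
          c ∈ selmerLocalKer (W.baseChange K) (Place.Completion v) ((2 ^ k * 2 ^ k : ℕ) : ℤ))
        (_hmc : ∀ q ∈ Sn, ((2 ^ k : ℕ) : ℤ) • galoisCohomology.localization ((W.baseChange K).torsionGaloisModule ((2 ^ k * 2 ^ k : ℕ) : ℤ))
          (Sum.inr q : Place K) 1 (k' • c) = 0)
        (_ht0 : ∀ q ∈ Sn', galoisCohomology.res ((W.baseChange K).torsionGaloisModule ((2 ^ k * 2 ^ k : ℕ) : ℤ))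
          (Place.Completion (Sum.inr q : Place K)) 1 (t : galH1Torsion (W.baseChange K) ((2 ^ k * 2 ^ k : ℕ) : ℤ)) = 0)
        (_htriv : ∀ q ∈ Sn', ∀ (g : absoluteGaloisGroup (Place.Completion (Sum.inr q : Place K)))
          (Q : geomTorsion (W.baseChange K) ((2 ^ k * 2 ^ k : ℕ) : ℤ)),
          absGaloisRestrict K (Place.Completion (Sum.inr q : Place K)) g • Q = Q)
        (_hcross : ∀ q ∈ Sn, q ∉ Sn' → ∃ ℓ : ℕ, τ • q = q ∧ Zhang2014.IsKolyvaginPrime (W.conductorNorm ℤ) W K 2 ℓ ∧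
          k + k ≤ Zhang2014.kolyvaginIndex W 2 ℓ ∧ FrobEqFrobInfty W K (2 ^ (k + k)) ℓ ∧ (ℓ : 𝓞 K) ∈ q.asIdeal),
        B x y = 0 := by
  haveI : IsTotallyComplex K := hK.2
  haveI : NeZero (2 ^ k) := ⟨pow_ne_zero _ two_ne_zero⟩
  haveI : NeZero (2 ^ k * 2 ^ k) := ⟨mul_ne_zero (NeZero.ne _) (NeZero.ne _)⟩
  have hpk : 2 ≤ 2 ^ k := le_trans (le_refl 2) (Nat.le_self_pow hk.ne' 2)
  have h2 : 2 ≤ 2 ^ k * 2 ^ k := le_trans hpk (Nat.le_mul_of_pos_right _ (NeZero.pos _))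
  -- the lift-equivariant Weil pairing on `E[2^{2k}]`
  obtain ⟨e, hμ, hadd₁, hadd₂, halt, hnd, hgal, hlift⟩ := exists_weilPairing_liftEquivariant W K (2 ^ k * 2 ^ k) h2
  have hmm : 2 ^ k * 2 ^ k = 2 ^ (k + k) := (pow_add 2 k k).symm
  have hM : 1 ≤ k + k := le_trans hk (Nat.le_add_right k k)
  refine ⟨ctLevelPairing (W.baseChange K) (2 ^ k) e hμ hadd₁ hadd₂ hgal (LocalInvariants.canonical K (2 ^ k * 2 ^ k)) halt
      (sumInvLocalizationEqZero_canonical_of_numberField K (2 ^ k * 2 ^ k))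
      (shaThree_mu_eq_zero_of_isTotallyComplex (K := K) (2 ^ k * 2 ^ k))
      (localTerm_finite_support (W.baseChange K) (2 ^ k) e hμ hadd₁ hadd₂ hgal halt (LocalInvariants.canonical K (2 ^ k * 2 ^ k))),
    ?_, ?_, ?_⟩
  · exact isLevelPairing_ctLevelPairing_canonical (W.baseChange K) 2 k e hμ hadd₁ hadd₂ hgal halt hnd hk
  · exact fun x hx =>
      exists_smul_eq_of_isLevelPairing_of_apply_eq_zero
        (isLevelPairing_ctLevelPairing_canonical (W.baseChange K) 2 k e hμ hadd₁ hadd₂ hgal halt hnd hk) x hx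
  · intro x y z t hx hy c k' hz hmt s hsc hst Sn Sn' hc hmc ht0 htriv hcross
    refine ctLevelPairing_eq_zero_of_opposite_signs W K hmm hK hΔ hM hτ1 hττ e hμ hadd₁ hadd₂ hgal halt
      (LocalInvariants.canonical K (2 ^ k * 2 ^ k)) (isConjCompatible_canonical τ (2 ^ k * 2 ^ k))
      (sumInvLocalizationEqZero_canonical_of_numberField K (2 ^ k * 2 ^ k))
      (shaThree_mu_eq_zero_of_isTotallyComplex (K := K) (2 ^ k * 2 ^ k))
      (localTerm_finite_support (W.baseChange K) (2 ^ k) e hμ hadd₁ hadd₂ hgal halt (LocalInvariants.canonical K (2 ^ k * 2 ^ k)))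
      hnofix x y z t hx hy c k' hz hmt hsc hst Sn Sn' hc hmc ht0 htriv fun q hq hq' => ?_
    obtain ⟨ℓ, hfix, hℓ, hidx, hF, hw⟩ := hcross q hq hq'
    exact ⟨ℓ, hfix, hℓ, hidx, hF, hw, fun S T => (hlift τ (liftAutPlace τ hfix) (isLiftOfAut_liftAutPlace τ hfix) S T).symm⟩

/-- **Level-currency form** of `exists_isLevelPairing_forall_opposite_signs_eq_zero`: the Selmer classes at a level `N` with `N = 2^k·2^k`
given as a hypothesis (instantiate `N := 2^L`, `L = 2k`, as in gk2-p2's `…RTPowDvdShaCardOfGrossWitnessOrthL`), the Kolyvagin-prime clause as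
`L ≤ M(ℓ) ∧ FrobEqFrobInfty W K (2^L) ℓ`; proof `subst`. [cite: McCallumLMS1991, §4 Prop. 4.7, §5 Lemma 5.3, Thm. 5.4]
[cite: MilneADT2006, Ch. I §6, Prop. 6.9, Thm. 6.13 (a)] -/
theorem exists_isLevelPairing_forall_opposite_signs_eq_zero_level (hK : IsImaginaryQuadratic K) (hΔ : W.Δ < 0) (k : ℕ) (hk : 0 < k)
    {N L : ℕ} (hN : N = 2 ^ k * 2 ^ k) (hL : L = k + k)
    {τ : K ≃ₐ[ℚ] K} (hτ1 : τ ≠ 1) (hττ : τ * τ = 1)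
    (hnofix : ∀ P : geomTorsion (W.baseChange K) ((2 ^ k : ℕ) : ℤ), (∀ g : absoluteGaloisGroup K, g • P = P) → P = 0) :
    ∃ B : ((W.baseChange K).sha)[((2 ^ k : ℕ) : ℤ)] →+ ((W.baseChange K).sha)[((2 ^ k : ℕ) : ℤ)] →+ AddCircle (1 : ℚ),
      IsLevelPairing (2 ^ k) B ∧
      (∀ x : ((W.baseChange K).sha)[((2 ^ k : ℕ) : ℤ)], B x = 0 → ∃ a : (W.baseChange K).sha, (2 ^ k) • a = (x : (W.baseChange K).sha)) ∧
      ∀ (x y : ((W.baseChange K).sha)[((2 ^ k : ℕ) : ℤ)]) (z t : selmerGroup (W.baseChange K) ((N : ℕ) : ℤ))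
        (_hx : shaTorsionVal (W.baseChange K) (2 ^ k) x = torsionH1ToH1 (W.baseChange K) ((N : ℕ) : ℤ) z)
        (_hy : shaTorsionVal (W.baseChange K) (2 ^ k) y = torsionH1ToH1 (W.baseChange K) ((N : ℕ) : ℤ) t)
        (c : galoisCohomology ((W.baseChange K).torsionGaloisModule ((N : ℕ) : ℤ)) 1) (k' : ℤ)
        (_hz : (z : galH1Torsion (W.baseChange K) ((N : ℕ) : ℤ)) = ((2 ^ k : ℕ) : ℤ) • k' • c)
        (_hmt : ((2 ^ k : ℕ) : ℤ) • (t : galH1Torsion (W.baseChange K) ((N : ℕ) : ℤ)) = 0)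
        (s : ℤ) (_hsc : conjAct W τ ((N : ℕ) : ℤ) (k' • c) = s • (k' • c))
        (_hst : conjAct W τ ((N : ℕ) : ℤ) (t : galH1Torsion (W.baseChange K) ((N : ℕ) : ℤ)) =
          -(s • (t : galH1Torsion (W.baseChange K) ((N : ℕ) : ℤ))))
        (Sn Sn' : Set (HeightOneSpectrum (𝓞 K)))
        (_hc : ∀ v : Place K, (∀ q ∈ Sn, v ≠ Sum.inr q) →
          c ∈ selmerLocalKer (W.baseChange K) (Place.Completion v) ((N : ℕ) : ℤ))
        (_hmc : ∀ q ∈ Sn, ((2 ^ k : ℕ) : ℤ) • galoisCohomology.localization ((W.baseChange K).torsionGaloisModule ((N : ℕ) : ℤ))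
          (Sum.inr q : Place K) 1 (k' • c) = 0)
        (_ht0 : ∀ q ∈ Sn', galoisCohomology.res ((W.baseChange K).torsionGaloisModule ((N : ℕ) : ℤ))
          (Place.Completion (Sum.inr q : Place K)) 1 (t : galH1Torsion (W.baseChange K) ((N : ℕ) : ℤ)) = 0)
        (_htriv : ∀ q ∈ Sn', ∀ (g : absoluteGaloisGroup (Place.Completion (Sum.inr q : Place K)))
          (Q : geomTorsion (W.baseChange K) ((N : ℕ) : ℤ)),
          absGaloisRestrict K (Place.Completion (Sum.inr q : Place K)) g • Q = Q)
        (_hcross : ∀ q ∈ Sn, q ∉ Sn' → ∃ ℓ : ℕ, τ • q = q ∧ Zhang2014.IsKolyvaginPrime (W.conductorNorm ℤ) W K 2 ℓ ∧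
          L ≤ Zhang2014.kolyvaginIndex W 2 ℓ ∧ FrobEqFrobInfty W K (2 ^ L) ℓ ∧ (ℓ : 𝓞 K) ∈ q.asIdeal),
        B x y = 0 := by
  subst hN hL
  exact exists_isLevelPairing_forall_opposite_signs_eq_zero W K hK hΔ k hk hτ1 hττ hnofix

end Main

end Summit.BirchSwinnertonDyer.BirchSwinnertonDyer.Theorems.GenusExact.PlusDescent

end
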